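import Summits.Parity.GeneralizedHardyLittlewood.Theorems.GreenTaoLevelTwoGITwoCyclicInverseGenFourierDecay

/-!
# Route `GreenTaoLevelTwo`, crux `GITwo` (stmt-Parity-21275), line `birth`, stub `stub_cyclicInverse`:
# Fourier decay of a regular Bohr set away from its polar body (GT08a arXiv Cor. 39)

Twenty-eighth helper file toward the XL stub `stub_cyclicInverse` (B. Green, T. Tao, *An inverse
theorem for the Gowers `U³(G)` norm*, arXiv:math/0503014, Thm. 68 = PEMS 51 (2008) Thm. 12.8).
Block B7, arXiv Corollary 39: for a regular Bohr set `B = B(S,ρ)` (`d = #S ≥ 1`), `0 < τ ≤ 1` and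
any frequency `ξ`, `|𝔼_{x∈B} e(ξ·x)| ≤ 64 (τ d/‖ξ‖_{B(S,τρ)})^{1/2}` where
`‖ξ‖_{B(S,τρ)} = sup_{y ∈ B(S,τρ)} ‖ξ·y‖_{ℝ/ℤ}` — obtained from arXiv Lemma 38
(`norm_phase_le_of_locAdd`) with the globally linear phase `φ(x) = ξ·x = toAddCircle(xξ)`.
We state it sup-free and square-free: for every `y ∈ B(S,τρ)`,
`|Σ_{x∈B} e(ξ·x)|² · ‖ξ·y‖_{ℝ/ℤ} ≤ 2¹² d τ (#B)²`.

* `norm_sum_sq_mul_norm_le_of_regular` — **arXiv Cor. 39** in the form just displayed.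

References: [GreenTao2008U3Inverse] arXiv:math/0503014, Cor. 39 (from Lemma 38).
-/

noncomputable section

namespace Summit.Parity.GeneralizedHardyLittlewood.GreenTaoLevelTwoGITwoCyclicInverse

open Finset

variable {N : ℕ} [NeZero N]

/-- **Fourier decay of a regular Bohr set (GT08a arXiv Cor. 39).**  Let `S ⊆ ℤ/Nℤ` be nonempty
(`d = #S`), `ρ > 0`, `B = B(S,ρ)` regular (arXiv Def. 16), `0 < τ` (the paper's `τ ≤ 1` is not
needed), `ξ ∈ ℤ/Nℤ`.  Then for
every `y ∈ B(S, τρ)`: `|Σ_{x∈B} e(xξ/N)|² · ‖yξ/N‖_{ℝ/ℤ} ≤ 2¹² d τ (#B)²`, i.e.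
`|𝔼_{x∈B} e(ξ·x)| ≤ 64 (τ d/‖ξ‖_{B(S,τρ)})^{1/2}`. [cite: GreenTao2008U3Inverse, Cor. 39] -/
theorem norm_sum_sq_mul_norm_le_of_regular (S : Finset (ZMod N)) (hS : S.Nonempty) {ρ τ : ℝ}
    (hρ : 0 < ρ) (hτ : 0 < τ)
    (hreg : ∀ κ : ℝ, |κ| ≤ 1 / (100 * (#S : ℝ)) →
      (1 - 100 * (#S : ℝ) * |κ|) * #{x : ZMod N | ∀ ξ ∈ S, ‖ZMod.toAddCircle (x * ξ)‖ < ρ} ≤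
          #{x : ZMod N | ∀ ξ ∈ S, ‖ZMod.toAddCircle (x * ξ)‖ < (1 + κ) * ρ} ∧
        (#{x : ZMod N | ∀ ξ ∈ S, ‖ZMod.toAddCircle (x * ξ)‖ < (1 + κ) * ρ} : ℝ) ≤
          (1 + 100 * (#S : ℝ) * |κ|) * #{x : ZMod N | ∀ ξ ∈ S, ‖ZMod.toAddCircle (x * ξ)‖ < ρ})
    (ξ : ZMod N) {y : ZMod N} (hy : ∀ ξ' ∈ S, ‖ZMod.toAddCircle (y * ξ')‖ < τ * ρ) :
    ‖∑ x ∈ ({x : ZMod N | ∀ ξ ∈ S, ‖ZMod.toAddCircle (x * ξ)‖ < ρ} : Finset (ZMod N)),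
        ((AddCircle.toCircle (ZMod.toAddCircle (x * ξ)) : Circle) : ℂ)‖ ^ 2 *
        ‖ZMod.toAddCircle (y * ξ)‖ ≤
      2 ^ 12 * (#S : ℝ) * τ *
        (#{x : ZMod N | ∀ ξ ∈ S, ‖ZMod.toAddCircle (x * ξ)‖ < ρ} : ℝ) ^ 2 := by
  classical
  set B : Finset (ZMod N) := {x : ZMod N | ∀ ξ ∈ S, ‖ZMod.toAddCircle (x * ξ)‖ < ρ} with hBdef
  set T : ℂ := ∑ x ∈ B, ((AddCircle.toCircle (ZMod.toAddCircle (x * ξ)) : Circle) : ℂ) with hT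
  have hc0 : (0 : ℝ) < #B := by
    have h1 : 1 ≤ #B := one_le_card_bohr S hρ
    exact_mod_cast h1
  -- the trivial case `T = 0`
  rcases eq_or_lt_of_le (norm_nonneg T) with hT0 | hTpos
  · rw [← hT0]
    have : 0 ≤ 2 ^ 12 * (#S : ℝ) * τ * (#B : ℝ) ^ 2 := by positivity
    simpa using this
  -- `η = ‖T‖ / #B ∈ (0, 1]`
  set η : ℝ := ‖T‖ / #B with hη
  have hη0 : 0 < η := by positivity
  have hTle : ‖T‖ ≤ #B := by
    rw [hT]
    calc ‖∑ x ∈ B, ((AddCircle.toCircle (ZMod.toAddCircle (x * ξ)) : Circle) : ℂ)‖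
        ≤ ∑ x ∈ B, ‖((AddCircle.toCircle (ZMod.toAddCircle (x * ξ)) : Circle) : ℂ)‖ :=
          norm_sum_le _ _
      _ = ∑ x ∈ B, (1 : ℝ) := sum_congr rfl fun x _ => Circle.norm_coe _
      _ = #B := by simp
  have hη1 : η ≤ 1 := by rw [hη, div_le_one hc0]; exact hTle
  have hbias : η * #B ≤ ‖T‖ := by rw [hη, div_mul_cancel₀ _ hc0.ne']
  -- the globally linear phase `x ↦ xξ/N`
  have hloc : ∀ x ∈ B, ∀ y ∈ B, (fun z : ZMod N => ZMod.toAddCircle (z * ξ)) (x + y) =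
      (fun z : ZMod N => ZMod.toAddCircle (z * ξ)) x + (fun z : ZMod N => ZMod.toAddCircle (z * ξ)) y :=
    fun x _ y _ => by simp only [add_mul, map_add]
  have hyB : ∀ ξ' ∈ S, ‖ZMod.toAddCircle (y * ξ')‖ ≤ τ * ρ := fun ξ' hξ' => (hy ξ' hξ').le
  have h38 := norm_phase_le_of_locAdd S hS hρ hη0 hη1 hreg (φ := fun z => ZMod.toAddCircle (z * ξ))
    hloc hbias (y := y) (by positivity : 0 < τ * ρ) hyB
  -- `‖yξ‖ ≤ 2¹² d (τρ)/(ρ η²) = 2¹² d τ #B² / ‖T‖²`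
  have hη2 : 0 < ρ * η ^ 2 := by positivity
  rw [le_div_iff₀ hη2] at h38
  have hkey : ‖ZMod.toAddCircle (y * ξ)‖ * η ^ 2 ≤ 2 ^ 12 * (#S : ℝ) * τ := by
    have := h38
    nlinarith [norm_nonneg (ZMod.toAddCircle (y * ξ))]
  have hηT : η * #B = ‖T‖ := by rw [hη, div_mul_cancel₀ _ hc0.ne']
  calc ‖T‖ ^ 2 * ‖ZMod.toAddCircle (y * ξ)‖ = (‖ZMod.toAddCircle (y * ξ)‖ * η ^ 2) * (#B : ℝ) ^ 2 := by
        rw [← hηT]; ring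
    _ ≤ 2 ^ 12 * (#S : ℝ) * τ * (#B : ℝ) ^ 2 :=
        mul_le_mul_of_nonneg_right hkey (by positivity)

end Summit.Parity.GeneralizedHardyLittlewood.GreenTaoLevelTwoGITwoCyclicInverse
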